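import Mathlib

/-!
# Kronecker's theorem for norm-one units of a CM field, and discreteness from a finite intersection

Kernel annex of sub-claim B5 (single-level positivity + level), file 8 — two elementary steps of
Remark B5.9 of the owner section `route/T4-B5-p8.md` (the proviso of m-fold positivity; NOT used
by Theorem A):

* `exists_pow_eq_one_of_mul_conj_eq_one` — Kronecker's theorem in the form used there: in a
  number field `E` with an involution `c` that is complex conjugation under every embedding
  `E → ℂ` (the CM condition, a hypothesis), an algebraic integer `u` with `u · c u = 1` is a root of
  unity. Proof: `|φ u|² = φ u · conj (φ u) = φ (u · c u) = 1` for every `φ`, and Mathlib's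
  `NumberField.Embeddings.pow_eq_one_of_norm_eq_one` (an algebraic integer all of whose conjugates
  have absolute value `1` is a root of unity).
* `discreteTopology_of_finite_inter` — the topological step «an open subgroup `U'` of `U` missing
  the finitely many non-trivial elements of `Γ ∩ U` has `Γ ∩ U' = {1}`, i.e. `Γ` is discrete»: in a
  topological group whose open subgroups form a neighbourhood basis at `1` (a hypothesis; true for
  `(A_E^∞)^1`), a subgroup `Γ` meeting some open subgroup `U` in a finite set is discrete. Together
  with Mathlib's `Subgroup.isClosed_of_discrete` (a discrete subgroup of a Hausdorff topological
  group is closed), this is the Hausdorff step of Remark B5.9.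

Nothing adelic is asserted: that `E^1 ∩ ∏_v O_{E_v}^1` consists of algebraic integers, and that the
open subgroups of `(A_E^∞)^1` form a neighbourhood basis at `1`, enter as hypotheses.
-/

namespace Summit.Ventures.HodgeRepro2.LevelPositivity

section Kronecker

variable {E : Type*} [Field E] [NumberField E]

/-- Kronecker's theorem for a CM-type involution: if `c : E → E` is complex conjugation under
every embedding `φ : E → ℂ` (`φ (c x) = conj (φ x)`), then an algebraic integer `u ∈ E` with
`u · c u = 1` is a root of unity. -/
theorem exists_pow_eq_one_of_mul_conj_eq_one (c : E →+* E)
    (hc : ∀ (φ : E →+* ℂ) (x : E), φ (c x) = starRingEnd ℂ (φ x)) {u : E}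
    (hu : IsIntegral ℤ u) (huc : u * c u = 1) : ∃ n : ℕ, 0 < n ∧ u ^ n = 1 := by
  have hnorm : ∀ φ : E →+* ℂ, ‖φ u‖ = 1 := by
    intro φ
    have h1 : φ u * starRingEnd ℂ (φ u) = 1 := by
      rw [← hc, ← map_mul, huc, map_one]
    have h2 : ((Complex.normSq (φ u) : ℝ) : ℂ) = 1 := by
      rw [← Complex.mul_conj, h1]
    have h3 : Complex.normSq (φ u) = 1 := by exact_mod_cast h2
    rw [Complex.normSq_eq_norm_sq] at h3
    exact (pow_eq_one_iff_of_nonneg (norm_nonneg _) two_ne_zero).1 h3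
  obtain ⟨n, hn, hun⟩ := NumberField.Embeddings.pow_eq_one_of_norm_eq_one E ℂ hu hnorm
  exact ⟨n, hn, hun⟩

end Kronecker

section Discrete

variable {G : Type*} [Group G] [TopologicalSpace G]

/-- A subgroup `Γ` of a topological group whose open subgroups form a neighbourhood basis at `1`
(Hausdorff, i.e. `T1`) is discrete as soon as it meets some open subgroup `U` in a finite set: an
open subgroup `U' ≤ U` avoiding the finitely many non-trivial elements of `Γ ∩ U` has `Γ ∩ U' = {1}`, so `{1}` is
open in `Γ`, and `Γ` is discrete by homogeneity. -/
theorem discreteTopology_of_finite_inter [IsTopologicalGroup G] [T1Space G]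
    (hbasis : ∀ W ∈ nhds (1 : G), ∃ U' : OpenSubgroup G, (U' : Set G) ⊆ W) (Γ : Subgroup G)
    (U : OpenSubgroup G) (hfin : ((Γ : Set G) ∩ U).Finite) : DiscreteTopology Γ := by
  classical
  -- the finite set of non-trivial elements of Γ ∩ U, and an open neighbourhood of 1 avoiding it
  set F : Set G := ((Γ : Set G) ∩ U) \ {1} with hF
  have hFfin : F.Finite := hfin.sdiff
  have hW : (U : Set G) ∩ Fᶜ ∈ nhds (1 : G) := by
    apply Filter.inter_mem (U.isOpen.mem_nhds U.one_mem)
    apply hFfin.isClosed.isOpen_compl.mem_nhds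
    simp [hF]
  obtain ⟨U', hU'⟩ := hbasis _ hW
  -- Γ ∩ U' = {1}
  have hΓU' : ∀ γ ∈ Γ, γ ∈ U' → γ = 1 := by
    intro γ hγ hγU'
    have hmem := hU' hγU'
    by_contra hne
    exact hmem.2 ⟨⟨hγ, hmem.1⟩, hne⟩
  -- {1} is open in Γ, hence Γ is discrete
  refine discreteTopology_iff_isOpen_singleton_one.2 ?_
  have : ({1} : Set Γ) = Subtype.val ⁻¹' (U' : Set G) := by
    ext γ
    constructor
    · rintro rfl
      exact U'.one_mem
    · intro hγ
      exact Subtype.ext (hΓU' γ γ.2 hγ)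
  rw [this]
  exact U'.isOpen.preimage continuous_subtype_val

end Discrete

end Summit.Ventures.HodgeRepro2.LevelPositivity
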